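import Summits.HodgeConjecture.HodgeConjecture.Theorems.F0P6aCanonicalTwistIdealAsReflexTypeNorm   -- ★ p849648 (LA4-p04 (g2)): §1 Galois self-case, §2 `prod_filter_ker_eq_idealReflexTypeNorm`, §3 `canonicalTwistIdeal_eq_idealReflexTypeNorm(_sigma)`
import HarnessLib

/-!
# Crux `HLiu418` — P6 sub-line **F0-P6a**, (S7) PIN IN JUNCTION CURRENCY, ideal-level core: the reflex type norm is INVARIANT UNDER AN ISOMORPHISM OF THE FIELD
# OF DEFINITION (`k′ ≅ k`, e.g. `F ≅ E♯ = reflexField F Φ_tw ι₁ = ι₁(F)`), and the (S7) pins of ★ p849648 read over any such `k`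

Cell `hodgecm-mathlib` (D-0151), crux `stmt-HodgeConjecture-24832` (hLiu418), `--supports` only (count-neutral).  «L4» LA4-p05 (g4) DEAL #30 `stub_TWIST`
sub-ask BY NAME 2026-09-02T07:26:58Z «(S7) PIN IN JUNCTION CURRENCY» (junction `z = reflexNormFiniteIdele F Φ_tw E♯ sE` of the (S8) skeleton v2 934d75ea): the idelic
side (★ `toFractionalIdeal_reflexNormFiniteIdele`, ★ `toFractionalIdeal_finiteIdeleConorm`, `map_inv`, ★ `fracIdealReflexTypeNorm_coeIdeal`) lands on
`idealReflexTypeNorm (valuedIn ι Φ_tw.1) j σL (𝔭_w · 𝓞_{E♯})` with the field of definition `k := E♯ = reflexField F Φ_tw ι₁`, an `IntermediateField ℚ ℂ` ISOMORPHIC to `F`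
(`F ∕ ℚ` Galois: ★ `reflexField_eq_fieldRange_of_isGalois`, the map `toReflexField`); ★ p849648 computes the norm for `k = F` AS A TYPE.  THIS FILE is the one missing
generic brick (B1): **the reflex type norm of ideals commutes with an isomorphism `e : k′ ≃+* k` of the field of definition** — `g_{(k, σL)}(e(𝔞)) = g_{(k′, σL ∘ e)}(𝔞)`
(§1, a reindexing `Ψ_j(k) ∘ e = Ψ_j(k′)` inside the descent identity; no `relNorm`) — and the two ★ p849648 pins transported along it (§2): the embedding product
`∏_{τ : σ_w ∘ τ ∈ Φ_Ω} 𝔭_τ` and the canonical twist ideal token `𝔞_can(M ∘ (σ_w ∘ ·), τR, w)` equal `g_{(E, σL)}(e(𝔭_w))` for ANY number field `E` with `e : F ≃+* E`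
and `σL : E → Lg` such that `ι ∘ σL ∘ e = σ_w|_F`.  THEOREMS ONLY (no definition, no instance, no notation, no named fact, no `sorry`); no `Lines` import.

MAIN STATEMENTS.  §1 `reflexNormIdeal_map_ringEquiv`, **`idealReflexTypeNorm_map_ringEquiv`**; §2 **`prod_filter_ker_eq_idealReflexTypeNorm_map_ringEquiv`**,
**`canonicalTwistIdeal_eq_idealReflexTypeNorm_sigma_map_ringEquiv`**.  Consumer (LA4-p05 #30, `E := ↥E♯`, `e :=` the equivalence behind `toReflexField F Φ_tw ι₁`,
`ΦΩ := Φ_tw.1`, then ★ p849648-snippet #3 for the `KottAdaptedAt` filter identity): `toFractionalIdeal (reflexNormFiniteIdele F Φ_tw E♯ sE) = (↑𝔞_can)⁻¹` once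
`toFractionalIdeal sE = (↑(𝔭_w.map (mapRingHom e)))⁻¹`.

HC_CM is proved only modulo the 7 printed citations (2 remaining named inputs hLiu418 24832, h413 24833) until rung 0 closes; nothing here changes a count.
[cite: MilneCM2006, Ch. I §1 Rem. 1.25, Prop. 1.26 (11)] [cite: Shimura1998, §13.1 (1), (7) and Theorem 1 (pp. 97–99); §8.3 Prop. 28–29 (p. 63)]
[cite: Liu2021, App. C Lem. C.14 and Rem. C.15 (p. 113)]
-/

set_option autoImplicit false
set_option linter.dupNamespace false  -- `Summit.HodgeConjecture.HodgeConjecture.…` BY DESIGN (D-0017)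

noncomputable section

open NumberField IsDedekindDomain IsLocalRing
open scoped Pointwise
open Literature.NumberTheory.GaloisRepresentations (closureValuationSubring)
open Literature.NumberTheory.Automorphic
open Literature.NumberTheory.ComplexMultiplication
open Summit.HodgeConjecture.HodgeConjecture.Theorems.F0P6aCanonicalTwistIdealAsReflexTypeNorm
  (prod_filter_ker_eq_idealReflexTypeNorm canonicalTwistIdeal_eq_idealReflexTypeNorm_sigma)

namespace Summit.HodgeConjecture.HodgeConjecture.Theorems.F0P6aReflexTypeNormBaseTransport

/-! ### §1 The reflex type norm of ideals along an isomorphism of the field of definition -/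

section Transport

variable {K k k' Lg : Type} [Field K] [NumberField K] [Field k] [NumberField k] [Field k'] [NumberField k'] [Field Lg] [NumberField Lg]

omit [NumberField K] [NumberField k] [NumberField k'] [NumberField Lg] in
/-- Extension along `σ ∘ e` is extension along `e` then along `σ`. [folklore] [cite: MilneCM2006, Ch. I §1 Rem. 1.25] -/
theorem map_mapRingHom_comp (σ : k →+* Lg) (e : k' →+* k) (𝔞 : Ideal (𝓞 k')) :
    𝔞.map (RingOfIntegers.mapRingHom (σ.comp e)) =
      (𝔞.map (RingOfIntegers.mapRingHom e)).map (RingOfIntegers.mapRingHom σ) := by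
  rw [Ideal.map_map]
  congr 1

omit [NumberField K] in
/-- **The reflex-type-norm ideal is invariant under an isomorphism of the field of definition**: for `e : k′ ≃+* k`,
`∏_{σ ∈ Ψ_j(k)} (e 𝔞)^σ 𝓞_{Lg} = ∏_{σ′ ∈ Ψ_j(k′)} 𝔞^{σ′} 𝓞_{Lg}` where `Ψ_j(k′)` is read from `σL ∘ e` — the reflex types correspond by `σ ↦ σ ∘ e`
(`G • (σL ∘ e) = (G • σL) ∘ e`), a bijection because `e` is surjective. [cite: Shimura1998, §13.1 (1), (7)] [cite: MilneCM2006, Ch. I §1 Rem. 1.25] -/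
theorem reflexNormIdeal_map_ringEquiv (Φ : Set (K →+* Lg)) (j : K →+* Lg) (σL : k →+* Lg) (e : k' ≃+* k) (𝔞 : Ideal (𝓞 k')) :
    reflexNormIdeal Φ j σL (𝔞.map (RingOfIntegers.mapRingHom (e : k' →+* k))) = reflexNormIdeal Φ j (σL.comp (e : k' →+* k)) 𝔞 := by
  classical
  rw [reflexNormIdeal_eq_prod, reflexNormIdeal_eq_prod]
  refine Finset.prod_nbij (fun σ : k →+* Lg => σ.comp (e : k' →+* k)) (fun σ hσ => ?_) (fun σ₁ _ σ₂ _ h => ?_)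
    (fun σ' hσ' => ?_) (fun σ _ => ?_)
  · -- `Ψ_j(k) ∘ e ⊆ Ψ_j(k′)`
    rw [Set.Finite.mem_toFinset, mem_reflexTypeOn_iff] at hσ ⊢
    obtain ⟨G, hG, rfl⟩ := hσ
    exact ⟨G, hG, rfl⟩
  · -- `· ∘ e` is injective (`e` surjective)
    refine RingHom.ext fun x => ?_
    obtain ⟨y, rfl⟩ := e.surjective x
    exact RingHom.congr_fun h y
  · -- `Ψ_j(k′) ⊆ Ψ_j(k) ∘ e`
    rw [Set.Finite.coe_toFinset, mem_reflexTypeOn_iff] at hσ'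
    obtain ⟨G, hG, rfl⟩ := hσ'
    exact ⟨G • σL, by rw [Finset.mem_coe, Set.Finite.mem_toFinset, mem_reflexTypeOn_iff]; exact ⟨G, hG, rfl⟩, rfl⟩
  · exact (map_mapRingHom_comp σ (e : k' →+* k) 𝔞).symm

variable [IsGalois ℚ Lg]

/-- **(B1) THE REFLEX TYPE NORM OF IDEALS COMMUTES WITH AN ISOMORPHISM OF THE FIELD OF DEFINITION**: `g_{(k, σL)}(e(𝔞)) = g_{(k′, σL ∘ e)}(𝔞)` for
`e : k′ ≃+* k` (uniqueness of the descent ★ `isReflexTypeNorm_iff_eq` + `reflexNormIdeal_map_ringEquiv`).  USE: `k := E♯ = reflexField F Φ_tw ι₁ ≅ F =: k′`.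
[cite: Shimura1998, §13.1 (1), (7)] [cite: MilneCM2006, Ch. I §1 Rem. 1.25, Prop. 1.26 (11)] [cite: Liu2021, App. C Rem. C.15 (p. 113)] -/
theorem idealReflexTypeNorm_map_ringEquiv (Φ : Set (K →+* Lg)) (j : K →+* Lg) (σL : k →+* Lg) (e : k' ≃+* k) (𝔞 : Ideal (𝓞 k')) :
    idealReflexTypeNorm Φ j σL (𝔞.map (RingOfIntegers.mapRingHom (e : k' →+* k))) = idealReflexTypeNorm Φ j (σL.comp (e : k' →+* k)) 𝔞 := by
  symm
  rw [← isReflexTypeNorm_iff_eq]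
  change Ideal.map (RingOfIntegers.mapRingHom j) _ = reflexNormIdeal Φ j σL _
  rw [reflexNormIdeal_map_ringEquiv]
  exact isReflexTypeNorm_idealReflexTypeNorm Φ j (σL.comp (e : k' →+* k)) 𝔞

end Transport

/-! ### §2 The two ★ p849648 pins transported: the embedding product ∕ `𝔞_can` token as `g_{(E, σL)}(e(𝔭_w))` for any `E ≅ F` -/

section Pins

variable {F : Type} [Field F] [NumberField F] [IsGalois ℚ F] (w : HeightOneSpectrum (𝓞 F))
  (τR : (F →+* AlgebraicClosure (w.adicCompletion F)) → (𝓞 F →+* ↥(closureValuationSubring (w.adicCompletion F))))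
  (hτR : ∀ (τ : F →+* AlgebraicClosure (w.adicCompletion F)) (x : 𝓞 F),
    ((τR τ x : ↥(closureValuationSubring (w.adicCompletion F))) : AlgebraicClosure (w.adicCompletion F)) = τ (x : F))
  {E : Type} [Field E] [NumberField E] (e : F ≃+* E)
  {Lg : Type} [Field Lg] [NumberField Lg] [IsGalois ℚ Lg] {Ω : Type} [Field Ω]

include hτR in
/-- **(S7) PIN, JUNCTION CURRENCY — the embedding product is the reflex type norm of `e(𝔭_w)` over ANY field of definition `E ≅ F`**: for `e : F ≃+* E`,
`σL : E → Lg`, `ι : Lg → Ω` with `ι ∘ σL ∘ e = σ_w|_F`, and any `Φ_Ω ⊆ Hom(F, Ω)`: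
`∏_{τ : σ_w ∘ τ ∈ Φ_Ω} ker (residue ∘ τR τ) = idealReflexTypeNorm {φ : F → Lg | ι ∘ φ ∈ Φ_Ω} j σL (𝔭_w.map e)` (§1 ∘ ★ p849648 §2).  Consumer: `E := ↥E♯`, `Φ_Ω := Φ_tw.1`
(`valuedIn ι Φ_tw.1 = {φ | ι ∘ φ ∈ Φ_tw.1}` definitionally). [cite: Shimura1998, §13.1 (7) and Theorem 1 (pp. 97–99)] [cite: MilneCM2006, Ch. I §1 Prop. 1.26 (11)] -/
theorem prod_filter_ker_eq_idealReflexTypeNorm_map_ringEquiv (ΦΩ : Set (F →+* Ω)) [DecidablePred (· ∈ ΦΩ)]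
    (σw : AlgebraicClosure (w.adicCompletion F) →+* Ω) (ι : Lg →+* Ω) (j : F →+* Lg) (σL : E →+* Lg)
    (hcompat : ι.comp (σL.comp (e : F →+* E)) = σw.comp (algebraMap F (AlgebraicClosure (w.adicCompletion F)))) :
    ∏ τ ∈ Finset.univ.filter (fun τ : F →+* AlgebraicClosure (w.adicCompletion F) => σw.comp τ ∈ ΦΩ),
        RingHom.ker ((residue ↥(closureValuationSubring (w.adicCompletion F))).comp (τR τ)) =
      idealReflexTypeNorm {φ : F →+* Lg | ι.comp φ ∈ ΦΩ} j σL (w.asIdeal.map (RingOfIntegers.mapRingHom (e : F →+* E))) := by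
  rw [idealReflexTypeNorm_map_ringEquiv]
  exact prod_filter_ker_eq_idealReflexTypeNorm w τR hτR ΦΩ σw ι j (σL.comp (e : F →+* E)) hcompat

variable [IsCMField F]

include hτR in
/-- **(S7) PIN, JUNCTION CURRENCY, σ-form** (the E-READINGS (FROB-can) ∕ ★ p849355 HEAD-σ token on the LEFT, literally):
`𝔞_can(M ∘ (σ_w ∘ ·), τR, w) = idealReflexTypeNorm {φ | M (ι ∘ φ) ≠ 0 ∧ ∃ τ, ι ∘ φ = σ_w ∘ τ ∧ τ ∤ c•w} j σL (𝔭_w.map e)` over any `E ≅ F` (§1 ∘ ★ p849648 §3).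
Under `KottAdaptedAt` the consumer replaces the right-hand type by `Φ_tw` (snippet #3 ∕ ★-side filter identity) and reads the inverse for the Milne-normalised
correspondent of the arithmetic Frobenius (`[s] = 𝔭_w⁻¹`, ★ `LocalFrobeniusArtinCorrespondent`). [cite: Shimura1998, §13.1 Theorem 1 (pp. 97–99) and (7)]
[cite: RapoportSmithlingZhang2020Diagonal, §4.1 (4.6) p. 16 and p. 17] -/
theorem canonicalTwistIdeal_eq_idealReflexTypeNorm_sigma_map_ringEquiv (M : (F →+* Ω) → ℕ)
    (σw : AlgebraicClosure (w.adicCompletion F) →+* Ω) (ι : Lg →+* Ω) (j : F →+* Lg) (σL : E →+* Lg)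
    (hcompat : ι.comp (σL.comp (e : F →+* E)) = σw.comp (algebraMap F (AlgebraicClosure (w.adicCompletion F)))) :
    (∏ τ ∈ Finset.univ.filter (fun τ : F →+* AlgebraicClosure (w.adicCompletion F) =>
        M (σw.comp τ) ≠ 0 ∧ RingHom.ker ((residue ↥(closureValuationSubring (w.adicCompletion F))).comp (τR τ)) ≠
          (((IsCMField.complexConj F) • w).asIdeal : Ideal (𝓞 F))),
      RingHom.ker ((residue ↥(closureValuationSubring (w.adicCompletion F))).comp (τR τ))) =
    idealReflexTypeNorm {φ : F →+* Lg | M (ι.comp φ) ≠ 0 ∧ ∃ τ : F →+* AlgebraicClosure (w.adicCompletion F),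
        ι.comp φ = σw.comp τ ∧ RingHom.ker ((residue ↥(closureValuationSubring (w.adicCompletion F))).comp (τR τ)) ≠
          (((IsCMField.complexConj F) • w).asIdeal : Ideal (𝓞 F))} j σL (w.asIdeal.map (RingOfIntegers.mapRingHom (e : F →+* E))) := by
  rw [idealReflexTypeNorm_map_ringEquiv]
  exact canonicalTwistIdeal_eq_idealReflexTypeNorm_sigma w τR hτR M σw ι j (σL.comp (e : F →+* E)) hcompat

end Pins

end Summit.HodgeConjecture.HodgeConjecture.Theorems.F0P6aReflexTypeNormBaseTransport

end
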